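import Literature.AlgebraicGeometry.Deformation.T1LiftingAuxiliaryAlgebras
import HarnessLib

/-!
# «`X_n` lifts to `A_{n+1}` if and only if `Y_{n−1}` is in the image of `T¹(X_n/A_n) → T¹(X_{n−1}/A_{n−1})`»:
# the STEPWISE (one level at a time) T¹-lifting criterion ([Tz10, Thm. 6.4, Prop. 6.5] = [Gr97, Thm. 1.8]/[Gr25, Thm. 1.14]
# «(Ran, Kawamata)»), in the coordinates of [FM99, p. 3]

Family `hodge` (computation cell `pub-hsemireg`, LIT-W seat «Kawamata ∕ Ran T¹-lifting as printed»), layer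
`Literature/AlgebraicGeometry/Deformation`, on top of `T1Lifting.lean` (the test algebras `A_n = k[t]/(t^{n+1})`,
`B_n = k[x, y]/(x^{n+1}, y²)`, `C_n = B_n/(xⁿy)`, the maps `i`, `bA`, `β`, `j`, `gC`, `jB`, `fB`, `fC`, the cartesian squares
`C_{n+1} ≅ B_n ×_{A_n} A_{n+1}` and — in characteristic zero — `A_{m+1} ≅ B_m ×_{C_m} A_m`, functors of Artin rings with
Schlessinger's (H₁) ∕ (H₄), and «Kawamata's argument, one index at a time» `ArtinFunctor.map_i_surjective_of_map_j_surjective`)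
and `T1LiftingAuxiliaryAlgebras.lean` (`T1Lifting.gC_comp_fC`). THEOREMS only (no definition, no named fact, no `sorry`).

The T¹-lifting theorem in the tree (`ArtinFunctor.map_i_succ_surjective_of_t1Lifting`, `ArtinFunctor.t1Lifting_theorem`,
`T1LiftingTheoremSmoothness`) concludes GLOBAL surjectivity `F(A_{m+1}) ↠ F(A_m)` from T¹-lifting at ALL levels. Print also
states the criterion ONE ELEMENT AND ONE LEVEL AT A TIME — the form in which a computation that has T¹-surjectivity only up
to some order can be used honestly. This file types that per-element form.

## Sources, verbatim

* [Tziolas2010SmoothingsNonisolatedSingularities] (N. Tziolas, «Smoothings of schemes with nonisolated singularities»,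
  Michigan Math. J. 59 (2010) 25–84 = arXiv:0808.0436v2 «final version»; store text paper:arxiv-0808.0436 chunks p0015–p0016,
  arXiv numbering; §6 read BY EYE ×2 on the arXiv PDF p. 15 — widen/LIT-W/KAWAMATA-RAN-T1-LIFTING-LOCATOR-SHEET.md §1.3 (f)),
  §6 «The T¹-lifting property»: «Let `D : Art(k) → Sets` be a deformation functor of some scheme `X` defined over a field
  of characteristic zero, i.e., a covariant functor that satisfies Schlessinger's conditions (H₁) and (H₂). Assume moreover
  that `D` has an obstruction space `T²_D`. … Let `B_n = k[x, y]/(x^{n+1}, y²)` and `C_n = k[x, y]/(x^{n+1}, y², xⁿy)`. There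
  are natural maps `α_n : A_{n+1} → A_n`, `β_n : B_n → A_n`, `γ_n : B_n → C_n`, `δ_n : C_n → B_{n−1}`, `ζ_n : A_n → C_n` and
  `ε_n : A_{n+1} → B_n` with `β_n(x) = t`, `β_n(y) = 0`, `ε_n(t) = x + y`, `ζ_n(t) = x + y`.» DEFINITION 6.1 «Let
  `[X_n, φ₀] ∈ D(A_n)`. Then we define `𝕋¹_D(X_n/A_n)` to be the set of isomorphism classes of pairs `(Y_n, ψ_n)` consisting
  of deformations `Y_n` of `X` over `B_n` and marking isomorphisms `ψ_n : Y_n ⊗_{B_n} A_n → X_n`.» DEFINITION 6.2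
  «([Kaw92], [Kaw97]). We say that the deformation functor `D` satisfies the T¹-lifting property if and only if for any
  `X_n ∈ D(A_n)` the natural map `φ_n : 𝕋¹_D(X_n/A_n) → 𝕋¹_D(X_{n−1}/A_{n−1})` is surjective, where
  `X_{n−1} = D(α_{n−1})(X_n)`.» THEOREM 6.3 «([Kaw92]). Let `D` be a deformation functor that satisfies the T¹-lifting
  property. Then `D` is smooth. In particular, if `D` has a hull, then its hull is smooth.» «In fact the proof of the
  previous theorem shows the following. THEOREM 6.4. Let `D` be a deformation functor, `X_n ∈ D(A_n)`,
  `X_{n−1} = D(α_n)(X_n)` and `Y_{n−1} = D(ε_{n−1})(X_n) ∈ 𝕋¹_D(X_{n−1}/A_{n−1})`. Then `X_n` lifts to `A_{n+1}`, i.e., is in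
  the image of `D(A_{n+1}) → D(A_n)`, if and only if `Y_{n−1}` is in the image of the natural map
  `φ_n : 𝕋¹_D(X_n/A_n) → 𝕋¹_D(X_{n−1}/A_{n−1})`.» «PROPOSITION 6.5. With assumptions as in Theorem (T1) [sic], let
  `Y_n ∈ 𝕋¹(X_n/A_n)` be a lifting of `Y_{n−1}`, i.e., `φ_n(Y_n) = Y_{n−1}`. Then there is a lifting `X_{n+1}` of `X_n` over
  `A_{n+1}` such that `Y_n = D(ε_n)(X_{n+1})`.» REMARK 6.8 «… a stronger version of the T¹-lifting property was introduced
  by Fantechi and Manetti [FaMa99]. According to their definition, a deformation functor `D` has the T¹-lifting property if,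
  for any `n ∈ ℕ`, the natural map `D(B_{n+1}) → D(B_n) ×_{D(A_n)} D(A_{n+1})` is surjective … Then naturally, for any
  `X_n ∈ D(A_n)` one can define `T¹_D(X_n/A_n) = {Y_n ∈ D(B_n), D(β_n)(Y_n) = X_n}` and then `D` has the new T¹-lifting
  property if and only if the natural map `T¹(X_n/A_n) → T¹(X_{n−1}/A_{n−1})` is surjective for any `X_n ∈ D(A_n)`. This is
  a stronger condition since it depends only on `D` and does not take into consideration any automorphisms of `X_n`.»
* [Gross1997DeformingCalabiYau] (M. Gross, «Deforming Calabi–Yau threefolds», Math. Ann. 308 (1997) 187–220, THEOREM 1.8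
  «(Ran)» = the author's 2025 revision arXiv:alg-geom/9506022v2, THEOREM 1.14 «(Ran, Kawamata)», p. 9; both read BY EYE ×2
  across seats — sheet §1.4 ∕ §1.4′; v2 wording): «… Let `X_n ∈ D(A_n)`, and let `X_{n−1}` be the image of `X_n` in
  `D(A_{n−1})`; let `α ∈ T¹(X_{n−1}/A_{n−1})` be given by the pair `(ε_{n−1,∗}X_n, ψ_{n−1})` … Then there exists
  `X_{n+1} ∈ D(A_{n+1})` with `D(α_n)(X_{n+1}) = X_n` if and only if `α` is in the image of the natural map
  `ξ_{n∗} : T¹(X_n/A_n) → T¹(X_{n−1}/A_{n−1})`.» («This proof is simply a very minor modification of Kawamata's proof of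
  Ran's T¹-lifting criterion in [18]» = [Kawamata1992UnobstructedDeformations].)
* [FantechiManetti1999T1Lifting] (authors' version p. 3, read BY EYE ×4 across seats), the two squares: l. 13–19
  «`C_{n+1} ≅ B_n ×_{A_n} A_{n+1}` … in particular the T¹-lifting condition can be rephrased by saying that, given a
  `c ∈ F(C_n)`, there exists `b ∈ F(B_n)` having the same projections to `B_{n−1}` and `A_n`»; l. 21–25 «The cartesian
  diagram (in characteristic zero) [`A_{m+1} ≅ B_m ×_{C_m} A_m`, `f(t) = x + y`] together with condition (H1)
  immediately implies that `F(A_{m+1}) → F(A_m)` is surjective and the theorem; in fact, this is essentially Kawamata's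
  proof.»

## Dictionary (print ↔ `T1Lifting.lean`)

`α_n = i k n : A_{n+1} → A_n` · `β_n = bA k n : B_n → A_n` · `γ_n = j k n : B_n → C_n` · `δ_{n+1} = jB k n : C_{n+1} → B_n` ·
`ζ_n = fC k n : A_n → C_n` · `ε_n = fB k n : A_{n+1} → B_n` · the restriction `B_{n+1} → B_n` (print's `φ_n` on `𝕋¹`) is
`β k n`. Tziolas' UNMARKED `T¹_D(X_n/A_n) = {Y_n ∈ D(B_n) : D(β_n)(Y_n) = X_n}` (Rem. 6.8) needs no definition: its elements
are the `b ∈ F(B_n)` with `F(bA)(b) = a`, and «`Y_{n−1}` is in the image of `T¹(X_n/A_n) → T¹(X_{n−1}/A_{n−1})`» reads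
`∃ b ∈ F(B_n), F(bA_n)(b) = X_n ∧ F(β_{n−1})(b) = F(ε_{n−1})(X_n)`.

## What this file proves (functors of Artin rings `F : Art_k → Sets` = `ArtinFunctor k`; THEOREMS only)

* §1 `T1Lifting.jB_comp_fC` — `δ_{n+1} ∘ ζ_{n+1} = ε_n` (`jB ∘ fC = fB`), the last arrow of the dictionary.
* §2 THE PER-ELEMENT CRITERION in the `ζ`-form, for `F` with (H₁), `char k = 0` ([Tz10, Thm. 6.4] ∕ [Gr97, Thm. 1.8] through
  [FM99, p. 3]'s square `A_{m+1} ≅ B_m ×_{C_m} A_m`): `ArtinFunctor.exists_map_i_eq_iff_exists_map_j_eq` —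
  `a ∈ F(A_m)` lifts to `F(A_{m+1})` iff `F(ζ_m)(a) ∈ F(C_m)` lifts along `γ_m` to `F(B_m)`; and WITH PRESCRIBED `ε`-IMAGE
  ([Tz10, Prop. 6.5]): `ArtinFunctor.exists_map_i_eq_and_map_fB_eq_iff` — for `b ∈ F(B_m)`, there is a lift `a′` of `a` with
  `F(ε_m)(a′) = b` iff `F(γ_m)(b) = F(ζ_m)(a)`. The «only if» halves hold in every characteristic and for every `F`.
* §3 THE PER-ELEMENT CRITERION in print's `T¹`-form ([Tz10, Thm. 6.4 with Rem. 6.8's unmarked `T¹_D`]; [Gr97, Thm. 1.8]), for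
  `F` with (H₄) (e.g. pro-representable), `char k = 0`: `ArtinFunctor.exists_map_i_eq_iff_exists_t1_lift` — `X_n ∈ F(A_{n+1})`
  lifts to `F(A_{n+2})` iff some `Y ∈ F(B_{n+1})` over `X_n` restricts to `F(ε_n)(X_n) ∈ F(B_n)`; and [Tz10, Prop. 6.5]:
  `ArtinFunctor.exists_map_i_eq_and_map_fB_eq_of_t1_lift` — the lift can be chosen with `F(ε_{n+1})(X_{n+2}) = Y`.
* §4 the per-level form of the tree's global theorem as a sanity link: T¹-lifting at ONE level `n` (every compatible pair
  over `(B_n, A_{n+1})` lifts to `B_{n+1}`) ⇒ `F(A_{n+2}) → F(A_{n+1})` onto (`ArtinFunctor.map_i_surjective_of_t1Lifting_at`),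
  (H₄), `char k = 0` — [Tz10, Thm. 6.4] summed over `X_n`.
* §5 THE PER-ELEMENT CRITERION UNDER PRINT'S OWN HYPOTHESES — (H₁), (H₂) and an obstruction space `T²`, `char k = 0`, levels
  `≥ 2` ([Tz10, Thm. 6.4] with Rem. 6.8's unmarked `T¹_D`; the «if» half = [FM99, Thm. A′]'s Claims 1–2 run for ONE element):
  `ArtinFunctor.exists_map_i_eq_iff_exists_t1_lift_of_obstructionSpace` — `X ∈ F(A_{n+2})` lifts to `F(A_{n+3})` iff some
  `Y ∈ F(B_{n+2})` over `X` restricts to `F(ε_{n+1})(X)`; with `T1Lifting.β_comp_fB`, `T1Lifting.bA_comp_fB` for «only if».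
* §6 THE FIRST LEVEL `A_1 → A_2` per element, under (H₁) + (H₂) ALONE (no `T²`; `char k = 0`):
  `ArtinFunctor.exists_map_i_one_eq_iff_exists_t1_lift` — `X ∈ F(A_1)` lifts to `F(A_2)` iff some `Y ∈ F(B_1)` over `X`
  restricts to `F(ε_0)(X) ∈ F(B_0)` ([FM99]'s separate `m = 1` step «`C_1 ≅ A_1 ×_k A_1`, (H₂)» run for one element:
  (H₂)-injectivity on `C_1 ≅ B_0 ×_{A_0} A_1`, `T1Lifting.isCartesian_jB_gC`, then §2).

## HONEST SCOPE

Print's Thm. 6.4 ∕ Prop. 6.5 ([Tz10]) and Thm. 1.8 ∕ 1.14 ([Gr97]) are stated for deformation functors with (H₁), (H₂) AND an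
obstruction space `T²` (resp. predeformation categories with (RS) and `T²`) in the MARKED `𝕋¹` (pairs with a marking
isomorphism; groupoid-valued). Typed here: the UNMARKED reading of [Tz10, Rem. 6.8] in [FM99]'s coordinates — the `ζ`-form for
every `F` with (H₁) (§2) and the `T¹`-form for `F` with (H₄) (§3), by Kawamata's square, which needs NO obstruction space and uses
`char k = 0` exactly once (`(x + y)^{m+1} = (m + 1)xᵐy`, `T1Lifting.isCartesian_fB_i`); AND the `T¹`-form under print's own
hypotheses (H₁) + (H₂) + obstruction space, levels `≥ 2` (§5), by [FM99, Thm. A′]'s Claims 1–2, and at the first level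
`A_1 → A_2` (§6; print's `n = 1`) by [FM99]'s separate `m = 1` argument run per element, which needs (H₁) + (H₂) only — so the
`T¹`-form criterion is in the tree at EVERY level for functors with (H₁), (H₂) and `T²`. NOT typed: the marked ∕ groupoid
statement for functors with automorphisms (where `𝕋¹ ≠ T¹`; [Gr97] v2 fn 2); print's Prop. 6.5 for general `F` ([Sch68]
`t_D`-action route; typed for (H₄) functors in §3); Tziolas' «explicit obstruction element» of §7; and [Kaw92]'s own wording
(not held). Nothing here says that any functor of the cell has (H₄), (H₁) or any lifting property, and
nothing here bears on HC ∕ HC_CM ∕ HC_AV.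
-/

noncomputable section

universe u

namespace Literature.AlgebraicGeometry.Deformation

open T1Lifting

variable {k : Type u} [Field k]

/-! ### §1 `δ ∘ ζ = ε` -/

/-- `δ_{n+1} ∘ ζ_{n+1} = ε_n`: `jB ∘ fC = fB : A_{n+1} → B_n` (`t ↦ x + y` either way; [Tz10]: «`ε_n(t) = x + y`,
`ζ_n(t) = x + y`»). [cite: Tziolas2010SmoothingsNonisolatedSingularities, §6 (before Def. 6.1)]
[cite: FantechiManetti1999T1Lifting, p. 3] -/
theorem T1Lifting.jB_comp_fC (n : ℕ) : (jB k n).comp (fC k (n + 1)) = fB k n :=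
  AdjoinRoot.algHom_ext (by
    rw [AlgHom.comp_apply]
    change jB k n (fC k (n + 1) (t k (n + 1))) = fB k n (t k (n + 1))
    rw [fC_t, ← AlgHom.comp_apply, jB_comp_j, fB_t]
    ext
    · rw [fst_β, fst_xy, i_t, fst_xy]
    · rw [snd_β, snd_xy, map_one, snd_xy])

/-! ### §2 The per-element criterion, `ζ`-form (functors with (H₁)) -/

/-- **[Tziolas2010SmoothingsNonisolatedSingularities, PROPOSITION 6.5] ∕ [Gross1997DeformingCalabiYau, Thm. 1.8], the lift with PRESCRIBED
`ε`-image, `ζ`-form, for functors with (H₁)** («let `Y_n ∈ 𝕋¹(X_n/A_n)` be a lifting of `Y_{n−1}` … Then there is a lifting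
`X_{n+1}` of `X_n` over `A_{n+1}` such that `Y_n = D(ε_n)(X_{n+1})`»): for `F` with (H₁), `char k = 0`, `a ∈ F(A_m)` and
`b ∈ F(B_m)`: there is `a′ ∈ F(A_{m+1})` with `F(α_m)(a′) = a` and `F(ε_m)(a′) = b` if and only if `F(γ_m)(b) = F(ζ_m)(a)` in
`F(C_m)` — (H₁) applied to [FM99, p. 3]'s cartesian square `A_{m+1} ≅ B_m ×_{C_m} A_m` (`T1Lifting.isCartesian_fB_i`, characteristic
zero) whose side `γ_m = j` is a small extension; «only if» is `j ∘ fB = fC ∘ i` and holds for every `F` in every characteristic.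
[cite: Tziolas2010SmoothingsNonisolatedSingularities, Prop. 6.5] [cite: Gross1997DeformingCalabiYau, Thm. 1.8]
[cite: FantechiManetti1999T1Lifting, p. 3] -/
theorem ArtinFunctor.exists_map_i_eq_and_map_fB_eq_iff [CharZero k] (F : ArtinFunctor.{u} k) (h1 : F.H1) (m : ℕ)
    (a : F.obj (artA k m)) (b : F.obj (artB k m)) :
    (∃ a' : F.obj (artA k (m + 1)), F.map (R := artA k (m + 1)) (S := artA k m) (i k m) a' = a ∧
        F.map (R := artA k (m + 1)) (S := artB k m) (fB k m) a' = b) ↔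
      F.map (R := artB k m) (S := artC k m) (j k m) b = F.map (R := artA k m) (S := artC k m) (fC k m) a := by
  constructor
  · rintro ⟨a', ha, hb⟩
    rw [← ha, ← hb, ← F.map_comp, ← F.map_comp, j_comp_fB]
  · intro hba
    obtain ⟨d, hdb, hda⟩ := h1 (R₀ := artC k m) (R₁ := artB k m) (R₂ := artA k m) (R₃ := artA k (m + 1))
      (j k m) (fC k m) (fB k m) (i k m) (isCartesian_fB_i k m) (isSmallExtension_j k m) b a hba
    exact ⟨d, hda, hdb⟩

/-- **[Tziolas2010SmoothingsNonisolatedSingularities, THEOREM 6.4] ∕ [Gross1997DeformingCalabiYau, Thm. 1.8 = arXiv v2 Thm. 1.14 «(Ran,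
Kawamata)»], `ζ`-form, for functors with (H₁)** («THEOREM 6.4. Let `D` be a deformation functor, `X_n ∈ D(A_n)`,
`X_{n−1} = D(α_n)(X_n)` and `Y_{n−1} = D(ε_{n−1})(X_n) ∈ 𝕋¹_D(X_{n−1}/A_{n−1})`. Then `X_n` lifts to `A_{n+1}`, i.e., is in the
image of `D(A_{n+1}) → D(A_n)`, if and only if `Y_{n−1}` is in the image of the natural map
`φ_n : 𝕋¹_D(X_n/A_n) → 𝕋¹_D(X_{n−1}/A_{n−1})`.»): for `F` with (H₁) and `char k = 0`, `a ∈ F(A_m)` is in the image of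
`F(A_{m+1}) → F(A_m)` if and only if `F(ζ_m)(a) ∈ F(C_m)` is in the image of `F(γ_m) : F(B_m) → F(C_m)` — and
`C_m ≅ B_{m−1} ×_{A_{m−1}} A_m` carries `F(ζ_m)(a)` to the pair `(Y_{m−1}, X_m) = (F(ε_{m−1})(a), a)` (§3 below for the
`T¹`-form under (H₄)). [cite: Tziolas2010SmoothingsNonisolatedSingularities, Thm. 6.4]
[cite: Gross1997DeformingCalabiYau, Thm. 1.8] [cite: FantechiManetti1999T1Lifting, p. 3] -/
theorem ArtinFunctor.exists_map_i_eq_iff_exists_map_j_eq [CharZero k] (F : ArtinFunctor.{u} k) (h1 : F.H1) (m : ℕ)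
    (a : F.obj (artA k m)) :
    (∃ a' : F.obj (artA k (m + 1)), F.map (R := artA k (m + 1)) (S := artA k m) (i k m) a' = a) ↔
      ∃ b : F.obj (artB k m),
        F.map (R := artB k m) (S := artC k m) (j k m) b = F.map (R := artA k m) (S := artC k m) (fC k m) a := by
  constructor
  · rintro ⟨a', ha⟩
    exact ⟨F.map (R := artA k (m + 1)) (S := artB k m) (fB k m) a',
      (F.exists_map_i_eq_and_map_fB_eq_iff h1 m a _).1 ⟨a', ha, rfl⟩⟩
  · rintro ⟨b, hb⟩
    obtain ⟨a', ha, -⟩ := (F.exists_map_i_eq_and_map_fB_eq_iff h1 m a b).2 hb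
    exact ⟨a', ha⟩

/-! ### §3 The per-element criterion, print's `T¹`-form (functors with (H₄)) -/

/-- Under (H₄), for `Y ∈ F(B_{n+1})` and `X ∈ F(A_{n+1})`: `F(γ_{n+1})(Y) = F(ζ_{n+1})(X)` in `F(C_{n+1})` iff `Y` lies over
`X` (`F(β_{n+1})(Y) = X`) and restricts to `F(ε_n)(X)` in `F(B_n)` — the bijectivity half of (H₄) on the square
`C_{n+1} ≅ B_n ×_{A_n} A_{n+1}` ([FantechiManetti1999T1Lifting, p. 3, l. 13–19]), `gC ∘ ζ = id`, `δ ∘ ζ = ε`.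
[cite: FantechiManetti1999T1Lifting, p. 3] [cite: Tziolas2010SmoothingsNonisolatedSingularities, Rem. 6.8] -/
theorem ArtinFunctor.map_j_eq_map_fC_iff (F : ArtinFunctor.{u} k) (h4 : F.H4) (n : ℕ) (X : F.obj (artA k (n + 1)))
    (Y : F.obj (artB k (n + 1))) :
    F.map (R := artB k (n + 1)) (S := artC k (n + 1)) (j k (n + 1)) Y =
        F.map (R := artA k (n + 1)) (S := artC k (n + 1)) (fC k (n + 1)) X ↔
      F.map (R := artB k (n + 1)) (S := artA k (n + 1)) (bA k (n + 1)) Y = X ∧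
        F.map (R := artB k (n + 1)) (S := artB k n) (β k n) Y =
          F.map (R := artA k (n + 1)) (S := artB k n) (fB k n) X := by
  have hgC : F.map (R := artC k (n + 1)) (S := artA k (n + 1)) (gC k n)
      (F.map (R := artA k (n + 1)) (S := artC k (n + 1)) (fC k (n + 1)) X) = X := by
    rw [← F.map_comp, gC_comp_fC, F.map_id]
  have hjB : F.map (R := artC k (n + 1)) (S := artB k n) (jB k n)
      (F.map (R := artA k (n + 1)) (S := artC k (n + 1)) (fC k (n + 1)) X) =
      F.map (R := artA k (n + 1)) (S := artB k n) (fB k n) X := by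
    rw [← F.map_comp, T1Lifting.jB_comp_fC]
  have hgCj : F.map (R := artC k (n + 1)) (S := artA k (n + 1)) (gC k n)
      (F.map (R := artB k (n + 1)) (S := artC k (n + 1)) (j k (n + 1)) Y) =
      F.map (R := artB k (n + 1)) (S := artA k (n + 1)) (bA k (n + 1)) Y := by
    rw [← F.map_comp, gC_comp_j]
  have hjBj : F.map (R := artC k (n + 1)) (S := artB k n) (jB k n)
      (F.map (R := artB k (n + 1)) (S := artC k (n + 1)) (j k (n + 1)) Y) =
      F.map (R := artB k (n + 1)) (S := artB k n) (β k n) Y := by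
    rw [← F.map_comp, jB_comp_j]
  constructor
  · intro h
    exact ⟨by rw [← hgCj, h, hgC], by rw [← hjBj, h, hjB]⟩
  · rintro ⟨hX, hε⟩
    obtain ⟨-, hinj⟩ := h4 (R₀ := artA k n) (R₁ := artA k (n + 1)) (R₂ := artB k n) (R₃ := artC k (n + 1))
      (i k n) (bA k n) (gC k n) (jB k n) (isCartesian_gC_jB k n) (isSmallExtension_i k n)
    exact hinj _ _ (by rw [hgCj, hX, hgC]) (by rw [hjBj, hε, hjB])

/-- **[Tziolas2010SmoothingsNonisolatedSingularities, THEOREM 6.4] ∕ [Gross1997DeformingCalabiYau, Thm. 1.8 = v2 Thm. 1.14 «(Ran,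
Kawamata)»], print's `T¹`-form, for functors with (H₄)** — «`X_n` lifts to `A_{n+1}` … if and only if
`Y_{n−1} = D(ε_{n−1})(X_n)` is in the image of `φ_n : 𝕋¹_D(X_n/A_n) → 𝕋¹_D(X_{n−1}/A_{n−1})`», with Tziolas' UNMARKED
`T¹_D(X_n/A_n) = {Y_n ∈ D(B_n) : D(β_n)(Y_n) = X_n}` (Rem. 6.8): for `F` with (H₄) ([FantechiManetti1998ObstructionCalculus, Def. 2.7]; e.g. pro-representable),
`char k = 0`, and `X ∈ F(A_{n+1})`: `X` is in the image of `F(A_{n+2}) → F(A_{n+1})` if and only if there is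
`Y ∈ F(B_{n+1})` with `F(β_{n+1})(Y) = X` whose restriction to `F(B_n)` is `F(ε_n)(X)`. (Index shift: print's `n` is
`n + 1` here.) [cite: Tziolas2010SmoothingsNonisolatedSingularities, Thm. 6.4 and Rem. 6.8] [cite: Gross1997DeformingCalabiYau, Thm. 1.8]
[cite: FantechiManetti1999T1Lifting, p. 3] -/
theorem ArtinFunctor.exists_map_i_eq_iff_exists_t1_lift [CharZero k] (F : ArtinFunctor.{u} k) (h4 : F.H4) (n : ℕ)
    (X : F.obj (artA k (n + 1))) :
    (∃ X' : F.obj (artA k (n + 2)), F.map (R := artA k (n + 2)) (S := artA k (n + 1)) (i k (n + 1)) X' = X) ↔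
      ∃ Y : F.obj (artB k (n + 1)), F.map (R := artB k (n + 1)) (S := artA k (n + 1)) (bA k (n + 1)) Y = X ∧
        F.map (R := artB k (n + 1)) (S := artB k n) (β k n) Y =
          F.map (R := artA k (n + 1)) (S := artB k n) (fB k n) X := by
  rw [F.exists_map_i_eq_iff_exists_map_j_eq h4.h1 (n + 1) X]
  exact exists_congr fun Y => F.map_j_eq_map_fC_iff h4 n X Y

/-- **[Tziolas2010SmoothingsNonisolatedSingularities, PROPOSITION 6.5], print's `T¹`-form, for functors with (H₄)** («let
`Y_n ∈ 𝕋¹(X_n/A_n)` be a lifting of `Y_{n−1}`, i.e., `φ_n(Y_n) = Y_{n−1}`. Then there is a lifting `X_{n+1}` of `X_n` over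
`A_{n+1}` such that `Y_n = D(ε_n)(X_{n+1})`»): for `F` with (H₄), `char k = 0`, `X ∈ F(A_{n+1})` and `Y ∈ F(B_{n+1})` over `X`
restricting to `F(ε_n)(X)`, there is `X′ ∈ F(A_{n+2})` over `X` with `F(ε_{n+1})(X′) = Y`.
[cite: Tziolas2010SmoothingsNonisolatedSingularities, Prop. 6.5] [cite: FantechiManetti1999T1Lifting, p. 3] -/
theorem ArtinFunctor.exists_map_i_eq_and_map_fB_eq_of_t1_lift [CharZero k] (F : ArtinFunctor.{u} k) (h4 : F.H4) (n : ℕ)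
    (X : F.obj (artA k (n + 1))) (Y : F.obj (artB k (n + 1)))
    (hX : F.map (R := artB k (n + 1)) (S := artA k (n + 1)) (bA k (n + 1)) Y = X)
    (hε : F.map (R := artB k (n + 1)) (S := artB k n) (β k n) Y =
      F.map (R := artA k (n + 1)) (S := artB k n) (fB k n) X) :
    ∃ X' : F.obj (artA k (n + 2)), F.map (R := artA k (n + 2)) (S := artA k (n + 1)) (i k (n + 1)) X' = X ∧
      F.map (R := artA k (n + 2)) (S := artB k (n + 1)) (fB k (n + 1)) X' = Y :=
  (F.exists_map_i_eq_and_map_fB_eq_iff h4.h1 (n + 1) X Y).2 ((F.map_j_eq_map_fC_iff h4 n X Y).2 ⟨hX, hε⟩)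

/-! ### §4 The per-level form of the tree's global theorem -/

/-- T¹-lifting AT ONE LEVEL gives lifting AT THE NEXT LEVEL (the per-level reading of
`ArtinFunctor.map_i_succ_surjective_of_t1Lifting`; [Tz10, Thm. 6.4] over all `X_n`): for `F` with (H₄), `char k = 0`, if every
compatible pair `(b, a) ∈ F(B_n) ×_{F(A_n)} F(A_{n+1})` lifts to `F(B_{n+1})` (Def. 1.1 of [FantechiManetti1999T1Lifting] at the
single level `n`), then `F(A_{n+2}) → F(A_{n+1})` is onto. [cite: Tziolas2010SmoothingsNonisolatedSingularities, Thm. 6.4]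
[cite: FantechiManetti1999T1Lifting, Def. 1.1 and p. 3] -/
theorem ArtinFunctor.map_i_surjective_of_t1Lifting_at [CharZero k] (F : ArtinFunctor.{u} k) (h4 : F.H4) (n : ℕ)
    (hT : ∀ (b : F.obj (artB k n)) (a : F.obj (artA k (n + 1))),
      F.map (R := artB k n) (S := artA k n) (bA k n) b = F.map (R := artA k (n + 1)) (S := artA k n) (i k n) a →
      ∃ b' : F.obj (artB k (n + 1)), F.map (R := artB k (n + 1)) (S := artB k n) (β k n) b' = b ∧
        F.map (R := artB k (n + 1)) (S := artA k (n + 1)) (bA k (n + 1)) b' = a) :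
    Function.Surjective (F.map (R := artA k (n + 2)) (S := artA k (n + 1)) (i k (n + 1))) := by
  intro X
  have hφ : (bA k n).comp (fB k n) = i k n := by
    rw [← T1Lifting.jB_comp_fC, ← AlgHom.comp_assoc]
    exact bA_comp_jB_comp_fC k n
  have hcomp : F.map (R := artB k n) (S := artA k n) (bA k n)
      (F.map (R := artA k (n + 1)) (S := artB k n) (fB k n) X) =
      F.map (R := artA k (n + 1)) (S := artA k n) (i k n) X := by
    rw [← F.map_comp, hφ]
  obtain ⟨Y, hε, hX⟩ := hT _ X hcomp
  exact (F.exists_map_i_eq_iff_exists_t1_lift h4 n X).2 ⟨Y, hX, hε⟩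

/-! ### §5 The per-element criterion under print's own hypotheses: (H₁), (H₂) and an obstruction space `T²` -/

/-- The restriction `B_{m+1} → B_m` and `ε` commute with `α`: `β ∘ ε_{m+1} = ε_m ∘ α_{m+1}` (`t ↦ x + y`).
[cite: Tziolas2010SmoothingsNonisolatedSingularities, §6 (before Def. 6.1)] [cite: FantechiManetti1999T1Lifting, Def. 1.1] -/
theorem T1Lifting.β_comp_fB (m : ℕ) : (β k m).comp (fB k (m + 1)) = (fB k m).comp (i k (m + 1)) :=
  AdjoinRoot.algHom_ext (by
    rw [AlgHom.comp_apply, AlgHom.comp_apply]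
    change β k m (fB k (m + 1) (t k (m + 2))) = fB k m (i k (m + 1) (t k (m + 2)))
    rw [fB_t, i_t, fB_t]
    ext
    · rw [fst_β, fst_xy, i_t, fst_xy]
    · rw [snd_β, snd_xy, map_one, snd_xy])

/-- `β_m ∘ ε_m = α_m` (`bA ∘ fB = i`: `t ↦ x + y ↦ x`). [cite: Tziolas2010SmoothingsNonisolatedSingularities, §6 (before Def. 6.1)]
[cite: FantechiManetti1999T1Lifting, Def. 1.1] -/
theorem T1Lifting.bA_comp_fB (m : ℕ) : (bA k m).comp (fB k m) = i k m := by
  rw [← T1Lifting.jB_comp_fC, ← AlgHom.comp_assoc]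
  exact bA_comp_jB_comp_fC k m

/-- **[Tziolas2010SmoothingsNonisolatedSingularities, THEOREM 6.4] UNDER PRINT'S OWN HYPOTHESES — (H₁), (H₂) AND AN
OBSTRUCTION SPACE `T²` — with [Tz10, Rem. 6.8]'s unmarked `T¹_D`** («Let `D : Art(k) → Sets` be a deformation functor
… (H₁) and (H₂). Assume moreover that `D` has an obstruction space `T²_D`. … THEOREM 6.4. Let `D` be a deformation
functor, `X_n ∈ D(A_n)`, … `Y_{n−1} = D(ε_{n−1})(X_n)`. Then `X_n` lifts to `A_{n+1}` … if and only if `Y_{n−1}` is in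
the image of the natural map `φ_n : 𝕋¹_D(X_n/A_n) → 𝕋¹_D(X_{n−1}/A_{n−1})`.»): for a functor of Artin rings `F` with
(H₁), (H₂) ([FantechiManetti1999T1Lifting, §0]) and an obstruction space (`ArtinFunctor.ObstructionSpace`, [FM99, Def. 0.1]),
`char k = 0`, and `X ∈ F(A_{n+2})` (print's `n` is `n + 2` here; levels `≥ 2`, as in [FM99, Thm. A′]'s «`m ≥ 2`» case): `X`
lifts to `F(A_{n+3})` if and only if there is `Y ∈ F(B_{n+2})` with `F(β_{n+2})(Y) = X` restricting to `F(ε_{n+1})(X)` in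
`F(B_{n+1})`. PROOF «if»: [FantechiManetti1999T1Lifting, pp. 3–5] Claims 1–2 verbatim for this one element (the tree's
`ArtinFunctor.t1Lifting_claim1`, `…_claim2`, then (H₁) on the char-0 cartesian square `V_{m+1} ≅ B_m ×_{C_m} V_m`,
`T1Lifting.isCartesian_fVup_iQ`) — the proof of `ArtinFunctor.map_i_surjective_of_t1Lifting_of_obstructionSpace` with its one
use of the T¹-lifting property replaced by the given `Y`; «only if»: `Y := F(ε_{n+2})(X′)`. NOT typed: print's Prop. 6.5
(prescribed `D(ε_n)(X_{n+1}) = Y_n`) for such general `F` (its printed proof goes through [Sch68]'s `t_D`-action, Thm. 6.6);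
§3 types it for (H₄) functors. [cite: Tziolas2010SmoothingsNonisolatedSingularities, Thm. 6.4 and Rem. 6.8]
[cite: Gross1997DeformingCalabiYau, Thm. 1.8] [cite: FantechiManetti1999T1Lifting, Theorem A′ (proof, Claims 1–2)] -/
theorem ArtinFunctor.exists_map_i_eq_iff_exists_t1_lift_of_obstructionSpace [CharZero k] (F : ArtinFunctor.{u} k)
    (h1 : F.H1) (h2 : F.H2) {T2 : Type u} [AddCommGroup T2] [Module k T2] (O : F.ObstructionSpace T2) (n : ℕ)
    (a : F.obj (artA k (n + 2))) :
    (∃ a' : F.obj (artA k (n + 3)), F.map (R := artA k (n + 3)) (S := artA k (n + 2)) (i k (n + 2)) a' = a) ↔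
      ∃ Y : F.obj (artB k (n + 2)), F.map (R := artB k (n + 2)) (S := artA k (n + 2)) (bA k (n + 2)) Y = a ∧
        F.map (R := artB k (n + 2)) (S := artB k (n + 1)) (β k (n + 1)) Y =
          F.map (R := artA k (n + 2)) (S := artB k (n + 1)) (fB k (n + 1)) a := by
  constructor
  · rintro ⟨a', rfl⟩
    refine ⟨F.map (R := artA k (n + 3)) (S := artB k (n + 2)) (fB k (n + 2)) a', ?_, ?_⟩
    · rw [← F.map_comp, T1Lifting.bA_comp_fB]
    · rw [← F.map_comp, ← F.map_comp, T1Lifting.β_comp_fB]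
  · rintro ⟨b, hb2, hb1'⟩
    -- `b ∈ F(B_m)` over `(j(c′), i(a))`, `c′ = f(a)`; `c = j(b)`, so `g(c) = a` and `j(c) = j(c′)`
    have hb1 : F.map (R := artB k (n + 2)) (S := artB k (n + 1)) (β k (n + 1)) b =
        F.map (R := artC k (n + 2)) (S := artB k (n + 1)) (jB k (n + 1))
          (F.map (R := artA k (n + 2)) (S := artC k (n + 2)) (fC k (n + 2)) a) := by
      rw [hb1', ← F.map_comp, T1Lifting.jB_comp_fC]
    have hgc : F.map (R := artC k (n + 2)) (S := artA k (n + 2)) (gC k (n + 1))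
        (F.map (R := artB k (n + 2)) (S := artC k (n + 2)) (j k (n + 2)) b) = a := by
      rw [← F.map_comp, gC_comp_j]; exact hb2
    have hjc : F.map (R := artC k (n + 2)) (S := artB k (n + 1)) (jB k (n + 1))
        (F.map (R := artB k (n + 2)) (S := artC k (n + 2)) (j k (n + 2)) b) =
        F.map (R := artC k (n + 2)) (S := artB k (n + 1)) (jB k (n + 1))
          (F.map (R := artA k (n + 2)) (S := artC k (n + 2)) (fC k (n + 2)) a) := by
      rw [← F.map_comp, jB_comp_j]; exact hb1
    -- CLAIM 1: `ξ ∈ F(A′_m)` with `f(ξ) = c`, `p(ξ) = a`; then also `q(ξ) = g(f(ξ)) = g(c) = a`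
    obtain ⟨ξ, hfA, hpA⟩ := F.t1Lifting_claim1 h1 h2 n a _ hjc
    have hqA : F.map (R := artA' k (n + 2)) (S := artA k (n + 2)) (qA' k (n + 1)) ξ = a := by
      rw [← hgc, ← hfA, ← F.map_comp, gC_comp_fA']
    -- CLAIM 2: `ξ` lifts to `v ∈ F(V_m)`
    obtain ⟨v, hv⟩ := F.t1Lifting_claim2 O n ξ (hpA.trans hqA.symm)
    -- `(b, v) ∈ F(B_m) ×_{F(C_m)} F(V_m)` lifts to `F(V_{m+1})` by (H1) on the char-0 cartesian square
    -- `V_{m+1} = B_m ×_{C_m} V_m`; its image under `q : V_{m+1} → A_{m+1}` lifts `a`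
    have hbv : F.map (R := artB k (n + 2)) (S := artC k (n + 2)) (j k (n + 2)) b =
        F.map (R := artV k (n + 2)) (S := artC k (n + 2)) (fV k (n + 1)) v := by
      rw [← hfA, ← hv, ← F.map_comp, ← fV_eq_comp]
    obtain ⟨v', -, hv'⟩ := h1 (R₀ := artC k (n + 2)) (R₁ := artB k (n + 2)) (R₂ := artV k (n + 2))
      (R₃ := artV k (n + 3)) (j k (n + 2)) (fV k (n + 1)) (fVup k (n + 1)) (iQ k (n + 2) 2)
      (isCartesian_fVup_iQ k (n + 1)) (isSmallExtension_j k (n + 2)) b v hbv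
    refine ⟨F.map (R := artV k (n + 3)) (S := artA k (n + 3)) (qVup k n) v', ?_⟩
    rw [← F.map_comp, i_comp_qVup', F.map_comp (S := artA' k (n + 2)), ρ, F.map_comp (S := artV k (n + 2)), hv', hv,
      hqA]

/-! ### §6 The first level `A_1 → A_2` per element, under (H₁) + (H₂) alone -/

/-- The cartesian square `C_{n+1} ≅ B_n ×_{A_n} A_{n+1}` of [FantechiManetti1999T1Lifting, p. 3] (`isCartesian_gC_jB`) with its
two legs listed in the other order — `C_{n+1} ≅ A_{n+1} ×_{A_n} B_n` over the small side `bA_n : B_n → A_n` —, the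
orientation in which the tree's (H₂) (`ArtinFunctor.H2`: squares over `B_0 → A_0 = k[ε] → k`) consumes it at `n = 0`.
[cite: FantechiManetti1999T1Lifting, p. 3] -/
theorem T1Lifting.isCartesian_jB_gC (n : ℕ) :
    IsCartesian k (R₀ := A k n) (R₁ := B k n) (R₂ := A k (n + 1)) (R₃ := C k (n + 1))
      (bA k n) (i k n) (jB k n) (gC k n) where
  comm := (isCartesian_gC_jB k n).comm.symm
  exists_lift := fun b a h => by
    obtain ⟨d, hd1, hd2⟩ := (isCartesian_gC_jB k n).exists_lift a b h.symm
    exact ⟨d, hd2, hd1⟩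
  lift_unique := fun d d' hB hA => (isCartesian_gC_jB k n).lift_unique d d' hA hB

/-- **[Tziolas2010SmoothingsNonisolatedSingularities, THEOREM 6.4] at the FIRST LEVEL (print's `n = 1`: «`X_1` lifts to `A_2` if and
only if `Y_0` is in the image of `𝕋¹_D(X_1/A_1) → 𝕋¹_D(X_0/A_0)`», unmarked `T¹_D` of Rem. 6.8) ∕ [Gross1997DeformingCalabiYau,
Thm. 1.8] at `n = 1`, for functors with (H₁) and (H₂) ONLY** (no obstruction space, `char k = 0`): for `X ∈ F(A_1)`, there is
`X′ ∈ F(A_2)` over `X` if and only if some `Y ∈ F(B_1)` lies over `X` (`F(β_1)(Y) = X`) and restricts along `B_1 → B_0` to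
`F(ε_0)(X) ∈ F(B_0)`. This is the level the general-level theorem `exists_map_i_eq_iff_exists_t1_lift_of_obstructionSpace`
(§5, levels `A_{n+2} → A_{n+3}`) leaves out; here [FantechiManetti1999T1Lifting]'s separate `m = 1` step («`F(A_2) → F(A_1)`
surjective» through `C_1 ≅ A_1 ×_k A_1 = B_0 ×_{A_0} A_1` and (H₂), p. 3–4) is run for ONE element: by (H₂) the pair of
restrictions `(F(δ_1), F(g))`, `g : C_1 → A_1`, is injective on `F(C_1)`, and `F(γ_1)(Y)`, `F(ζ_1)(X)` have the same
restrictions (`δ_1 γ_1 = β_0`-restriction of `Y` = `F(ε_0)(X) = F(δ_1 ζ_1)(X)`; `g γ_1 = β_1`, `g ζ_1 = id`), so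
`F(γ_1)(Y) = F(ζ_1)(X)` and §2's `ζ`-form criterion (H₁, Kawamata's square `A_2 ≅ B_1 ×_{C_1} A_1`) lifts `X`. «Only if»:
`Y = F(ε_1)(X′)`, any `F`, any characteristic. [cite: Tziolas2010SmoothingsNonisolatedSingularities, Thm. 6.4 and Rem. 6.8]
[cite: Gross1997DeformingCalabiYau, Thm. 1.8] [cite: FantechiManetti1999T1Lifting, p. 3–4 (the case `m = 1`)] -/
theorem ArtinFunctor.exists_map_i_one_eq_iff_exists_t1_lift [CharZero k] (F : ArtinFunctor.{u} k) (h1 : F.H1) (h2 : F.H2)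
    (a : F.obj (artA k 1)) :
    (∃ a' : F.obj (artA k 2), F.map (R := artA k 2) (S := artA k 1) (i k 1) a' = a) ↔
      ∃ Y : F.obj (artB k 1), F.map (R := artB k 1) (S := artA k 1) (bA k 1) Y = a ∧
        F.map (R := artB k 1) (S := artB k 0) (β k 0) Y =
          F.map (R := artA k 1) (S := artB k 0) (fB k 0) a := by
  constructor
  · rintro ⟨a', rfl⟩
    refine ⟨F.map (R := artA k 2) (S := artB k 1) (fB k 1) a', ?_, ?_⟩
    · rw [← F.map_comp, T1Lifting.bA_comp_fB]
    · rw [← F.map_comp, ← F.map_comp, T1Lifting.β_comp_fB]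
  · rintro ⟨b, hbA, hbB⟩
    refine (F.exists_map_i_eq_iff_exists_map_j_eq h1 1 a).2 ⟨b, ?_⟩
    -- (H₂) on `C_1 ≅ B_0 ×_{A_0} A_1`: `(F(jB_0), F(gC_0))` is injective on `F(C_1)`
    refine (h2 (R₂ := artA k 1) (R₃ := artC k 1) (i k 0) (jB k 0) (gC k 0) (T1Lifting.isCartesian_jB_gC (k := k) 0)).2 _ _ ?_ ?_
    · rw [← F.map_comp, ← F.map_comp, jB_comp_j, T1Lifting.jB_comp_fC]
      exact hbB
    · rw [← F.map_comp, ← F.map_comp, gC_comp_j, gC_comp_fC, F.map_id]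
      exact hbA

end Literature.AlgebraicGeometry.Deformation
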